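import Mathlib.LinearAlgebra.Dimension.Torsion.Finite
import Mathlib.LinearAlgebra.Dimension.Localization
import Literature.NumberTheory.EllipticCurves.QuadraticTwist
import Literature.NumberTheory.EllipticCurves.VariableChangePointsMap
import Literature.NumberTheory.EllipticCurves.MordellWeil
import Literature.NumberTheory.QuadraticFields.SquareRootGenerator
import HarnessLib

/-!
# The rank over a quadratic extension: `rank E(K) = rank E(F) + rank E^{(c)}(F)` for `K = F(√c)`

Silverman, *The Arithmetic of Elliptic Curves*, 2nd ed., Exercise 10.16: for a quadratic extension
`K = F(√c)` of a field `F` of characteristic `≠ 2` and a Weierstrass curve `E/F` with quadratic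
twist `E^{(c)}` (`WeierstrassCurve.quadraticTwist`, the model
`y² = x³ + c(b₂/4)x² + c²(b₄/2)x + c³(b₆/4)`),

`rank_ℤ E(K) = rank_ℤ E(F) + rank_ℤ E^{(c)}(F)`.

Everything in this file is proved. The proof is the standard eigenspace decomposition under
`Gal(K/F) = ⟨σ⟩`, carried out integrally (no tensoring with `ℚ`): with
`ι : E(F) → E(K)` the inclusion and `τ : E^{(c)}(F) → E(K)` the twisting map
`(X, Y) ↦ (X/c, Y θ/c²)` (`θ = √c`; the composite of base change and the change of variables
`u = θ` over `K`, so a group homomorphism by `VariableChange.pointEquiv`), one has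
`σ ∘ ι = ι`, `σ ∘ τ = -τ`, the `σ`-fixed points are `ι(E(F))` and the `σ`-anti-fixed points are
`τ(E^{(c)}(F))` (on the completed-square model `y² = f(x)`, where `-(x, y) = (x, -y)`). Hence
`im ι ∩ im τ` is killed by `2` and `2P = (P + σP) + (P - σP) ∈ im ι + im τ` for every
`P ∈ E(K)`, so `rank E(K) = rank (im ι + im τ) = rank im ι + rank im τ = rank E(F) + rank E^{(c)}(F)`
(`Literature.NumberTheory.EllipticCurves.rank_eq_add_of_isCompl_up_to_torsion`, rank–nullity over `ℤ`).

Main statements: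

* `WeierstrassCurve.lift_rank_point_baseChange_quadratic`: the identity of `ℤ`-ranks
  (`Module.rank`, as cardinals, valid without any finite generation hypothesis) for any field `F`
  with `2 ≠ 0`, `[K : F] = 2`, `K ∋ θ ∉ F`, `θ² = c`;
* `WeierstrassCurve.rank_point_baseChange_of_finrank_eq_two`: for `E/ℚ` and a quadratic number
  field `K`, `rank_ℤ E(K) = rank_ℤ E(ℚ) + rank_ℤ E^{(d_K)}(ℚ)` with `d_K` the discriminant
  (`K = ℚ(√d_K)` by `NumberField.exists_discr_eq_mul_sq`, and `E^{(c q²)} ≅ E^{(c)}`);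
* `WeierstrassCurve.mordellWeilRank_baseChange_of_finrank_eq_two`: the same for
  `WeierstrassCurve.mordellWeilRank` (`Module.finrank`), under the hypothesis that `rank_ℤ E(K)`
  is finite (e.g. `E(K)` finitely generated — the Mordell–Weil theorem — or `finrank ≠ 0`),
  which is exactly what makes `finrank` meaningful.

## References

* J. H. Silverman, *The Arithmetic of Elliptic Curves*, 2nd ed., GTM 106 (2009), X.2 Prop. 2.4,
  X.5 Cor. 5.4, Exercise 10.16.
* H. Darmon, *Rational points on modular elliptic curves*, CBMS 101 (2004), §3.9 (proof of
  Thm. 3.22, where the decomposition is used with `K` a Heegner field).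
-/

noncomputable section

open scoped Classical

open Module

universe u v

/-! ### A rank computation over `ℤ` -/

namespace Literature.NumberTheory.EllipticCurves

/-- A module killed by a non-zero-divisor has rank `0` (it is torsion; Mathlib
`rank_eq_zero_iff_isTorsion`). [folklore] -/
theorem rank_eq_zero_of_smul_eq_zero {R N : Type*} [CommRing R] [IsDomain R] [AddCommGroup N]
    [Module R N] {n : R} (hn : n ∈ nonZeroDivisors R) (h : ∀ x : N, n • x = 0) :
    Module.rank R N = 0 :=
  rank_eq_zero_iff_isTorsion.mpr fun x => ⟨⟨n, hn⟩, h x⟩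

/-- If two subgroups `A, B` of an abelian group `M` meet in an `n`-torsion group and `nM ⊆ A + B`
(`n ≠ 0`), then `rank_ℤ M = rank_ℤ A + rank_ℤ B` (rank–nullity over `ℤ`:
`rank (A ⊔ B) + rank (A ⊓ B) = rank A + rank B`, torsion groups have rank `0`). [folklore] -/
theorem rank_eq_add_of_isCompl_up_to_torsion {M : Type*} [AddCommGroup M] (A B : Submodule ℤ M)
    {n : ℤ} (hn : n ≠ 0) (hinf : ∀ x ∈ A ⊓ B, n • x = 0) (hsup : ∀ x : M, n • x ∈ A ⊔ B) :
    Module.rank ℤ M = Module.rank ℤ A + Module.rank ℤ B := by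
  have n0 : (n : ℤ) ∈ nonZeroDivisors ℤ := mem_nonZeroDivisors_of_ne_zero hn
  have h1 := Submodule.rank_sup_add_rank_inf_eq A B
  have h4 := Submodule.rank_quotient_add_rank (A ⊔ B)
  rw [rank_eq_zero_of_smul_eq_zero (N := ↥(A ⊓ B)) n0 fun x => Subtype.ext (hinf x x.2),
    add_zero] at h1
  -- the `Module ℤ` instance on the quotient is taken from `h4` (rank–nullity), by unification
  rw [rank_eq_zero_of_smul_eq_zero n0 ?_, zero_add] at h4
  · rw [← h4, h1]
  · intro x
    obtain ⟨x, rfl⟩ := Submodule.Quotient.mk_surjective _ x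
    rw [← Submodule.Quotient.mk_smul, Submodule.Quotient.mk_eq_zero]
    exact hsup x

end Literature.NumberTheory.EllipticCurves

namespace WeierstrassCurve

/-! ### Transport of the rank along a change of variables onto an equal equation -/

section Congr

variable {F : Type u} [Field F]

/-- The `ℤ`-rank of the point group is invariant under an admissible change of variables onto an
equal equation: `C • W₁ = W₂ → rank_ℤ W₁(F) = rank_ℤ W₂(F)` (`VariableChange.pointEquiv`;
Silverman, *AEC* III.3.1(b)). [folklore] -/
theorem rank_point_eq_of_variableChange {W₁ W₂ : WeierstrassCurve F} (C : VariableChange F)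
    (h : C • W₁ = W₂) : Module.rank ℤ W₁.toAffine.Point = Module.rank ℤ W₂.toAffine.Point :=
  ((VariableChange.pointEquiv W₁ C).trans (Affine.Point.congrEquiv h)).toIntLinearEquiv.rank_eq

end Congr

/-! ### The setting: `K = F(θ)`, `θ² = c`, and the model `E' = W^{(1)}` : `y² = f(x)` -/

section Quadratic

variable {F : Type u} {K : Type v} [Field F] [Field K] [Algebra F K]
  (W : WeierstrassCurve F) (h2 : finrank F K = 2) {θ : K} {c : F}
  (hθ : θ ∉ Set.range (algebraMap F K)) (hc : θ ^ 2 = algebraMap F K c)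

namespace QuadraticDescent

/-! ### The inclusion `ι : E(F) → E(K)` and the conjugation `σ` on `E(K)` -/

variable (K) in
/-- The inclusion `ι : V(F) →+ V(K)` of point groups along `F → K` (Mathlib's
`WeierstrassCurve.Affine.Point.baseChange`, a group homomorphism). [folklore] -/
abbrev incl (V : WeierstrassCurve F) : V.toAffine.Point →+ (V.baseChange K).toAffine.Point :=
  Affine.Point.baseChange (W' := V) F K

/-- `ι` is injective (Mathlib `Point.map_injective`). [folklore] -/
theorem incl_injective (V : WeierstrassCurve F) : Function.Injective (incl K V) :=
  Affine.Point.map_injective (W' := V) _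

/-- A point of `V(K)` with coordinates in `F` is in the image of `ι`. [folklore] -/
theorem exists_incl_eq (V : WeierstrassCurve F) {x y : K}
    (h : (V.baseChange K).toAffine.Nonsingular x y) {a b : F} (hx : algebraMap F K a = x)
    (hy : algebraMap F K b = y) : ∃ Q : V.toAffine.Point, incl K V Q = .some x y h := by
  subst hx hy
  exact ⟨.some a b ((Affine.baseChange_nonsingular (W := V) (f := Algebra.ofId F K)
    (algebraMap F K).injective a b).mp h), rfl⟩

/-- The action `σ_*` of an `F`-endomorphism `σ` of `K` on `V(K)` (Mathlib's
`WeierstrassCurve.Affine.Point.map`, a group homomorphism). [folklore] -/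
abbrev conjMap (V : WeierstrassCurve F) (σ : K →ₐ[F] K) :
    (V.baseChange K).toAffine.Point →+ (V.baseChange K).toAffine.Point :=
  Affine.Point.map (W' := V) σ

/-- `σ_*` fixes `ι(V(F))` (Mathlib `Point.map_baseChange`). [folklore] -/
theorem conjMap_incl (V : WeierstrassCurve F) (σ : K →ₐ[F] K) (Q : V.toAffine.Point) :
    conjMap V σ (incl K V Q) = incl K V Q :=
  Affine.Point.map_baseChange (W' := V) σ Q

/-- `σ_*` is an involution when `σ` is. [folklore] -/
theorem conjMap_conjMap (V : WeierstrassCurve F) {σ : K →ₐ[F] K} (hσ : ∀ z, σ (σ z) = z)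
    (P : (V.baseChange K).toAffine.Point) : conjMap V σ (conjMap V σ P) = P := by
  rcases P with _ | ⟨x, y, h⟩
  · rfl
  · simp only [Affine.Point.map_some, hσ]

/-- Negation on the completed-square model `y² = f(x)` over `K` is `(x, y) ↦ (x, -y)`. [folklore] -/
theorem negY_quadraticTwist_one_baseChange (x y : K) :
    ((W.quadraticTwist 1).baseChange K).toAffine.negY x y = -y := by
  simp [Affine.negY, baseChange]

end QuadraticDescent

variable [NeZero (2 : F)]

/-- The change of variables `u = θ = √c` over `K` carrying the twist `W^{(c)}` to the
completed-square model `W^{(1)}` (Silverman, *AEC* X.2, proof of Prop. 2.4 / X.5.4: `E^{(c)} ≅ E`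
over `F(√c)`). [cite: SilvermanAEC2009, X.5 Cor. 5.4] -/
def twistUntwist (hθ : θ ∉ Set.range (algebraMap F K)) : VariableChange K :=
  ⟨Units.mk0 θ (Literature.NumberTheory.QuadraticFields.Quadratic.ne_zero_of_not_mem_range hθ), 0, 0, 0⟩

include hc in
/-- Over `K = F(√c)` the twist becomes isomorphic to the curve:
`(u = θ) • (W^{(c)} ⊗ K) = W^{(1)} ⊗ K` on the nose (Silverman, *AEC* X.5 Cor. 5.4(iii)).
[cite: SilvermanAEC2009, X.5 Cor. 5.4] -/
theorem twistUntwist_smul_baseChange :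
    twistUntwist hθ • (W.quadraticTwist c).baseChange K = (W.quadraticTwist 1).baseChange K := by
  have hθ0 : θ ≠ 0 := Literature.NumberTheory.QuadraticFields.Quadratic.ne_zero_of_not_mem_range hθ
  have h4 : (4 : K) ≠ 0 := by
    rw [show (4 : K) = 2 * 2 by norm_num]
    exact mul_ne_zero (Literature.NumberTheory.QuadraticFields.Quadratic.two_ne_zero' (F := F)) (Literature.NumberTheory.QuadraticFields.Quadratic.two_ne_zero' (F := F))
  have h2K : (2 : K) ≠ 0 := Literature.NumberTheory.QuadraticFields.Quadratic.two_ne_zero' (F := F)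
  ext
  · simp [twistUntwist, baseChange, variableChange_a₁]
  · simp only [twistUntwist, baseChange, variableChange_a₂, map_a₁, map_a₂, quadraticTwist_a₁,
      quadraticTwist_a₂, map_zero, mul_zero, sub_zero, add_zero, one_mul,
      zero_pow two_ne_zero, map_div₀, map_mul, ← hc, map_ofNat, inv_pow, Units.val_inv_eq_inv_val,
      Units.val_mk0]
    field_simp
  · simp [twistUntwist, baseChange, variableChange_a₃]
  · simp only [twistUntwist, baseChange, variableChange_a₄, map_a₁, map_a₂, map_a₃, map_a₄,
      quadraticTwist_a₁, quadraticTwist_a₂, quadraticTwist_a₃, quadraticTwist_a₄, map_zero,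
      mul_zero, sub_zero, add_zero, zero_mul, one_pow, one_mul, map_div₀, map_mul, map_pow, ← hc,
      map_ofNat, inv_pow, Units.val_inv_eq_inv_val, Units.val_mk0, zero_pow two_ne_zero]
    field_simp
  · simp only [twistUntwist, baseChange, variableChange_a₆, map_a₁, map_a₂, map_a₃, map_a₄,
      map_a₆, quadraticTwist_a₁, quadraticTwist_a₂, quadraticTwist_a₃, quadraticTwist_a₄,
      quadraticTwist_a₆, map_zero, mul_zero, sub_zero, add_zero, zero_mul, one_pow, one_mul,
      map_div₀, map_mul, map_pow, ← hc, map_ofNat, inv_pow, Units.val_inv_eq_inv_val,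
      Units.val_mk0, zero_pow two_ne_zero, zero_pow three_ne_zero]
    field_simp


namespace QuadraticDescent

/-! ### The twisting map `τ : E^{(c)}(F) → E'(K)`, `E' = W^{(1)}` the completed square -/

/-- **The twisting map** `τ : W^{(c)}(F) →+ W^{(1)}(K)`, `(X, Y) ↦ (X/θ², Y/θ³) = (X/c, Yθ/c²)`:
base change to `K = F(θ)` followed by the change of variables `u = θ` (Silverman, *AEC* X.2,
proof of Prop. 2.4, and Exercise 10.16). A group homomorphism (`VariableChange.pointEquiv`).
[cite: SilvermanAEC2009, X.5 Cor. 5.4] -/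
def twistMap : (W.quadraticTwist c).toAffine.Point →+
    ((W.quadraticTwist 1).baseChange K).toAffine.Point :=
  (Affine.Point.congrEquiv (twistUntwist_smul_baseChange W hθ hc)).toAddMonoidHom.comp <|
    (VariableChange.pointEquiv ((W.quadraticTwist c).baseChange K)
      (twistUntwist hθ)).toAddMonoidHom.comp (incl K (W.quadraticTwist c))

/-- `τ` is injective. [folklore] -/
theorem twistMap_injective : Function.Injective (twistMap W hθ hc) := by
  unfold twistMap
  simp only [AddMonoidHom.coe_comp, AddEquiv.toAddMonoidHom_eq_coe, AddMonoidHom.coe_coe]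
  exact (AddEquiv.injective _).comp <| (AddEquiv.injective _).comp (incl_injective _)

/-- `τ` on an affine point: `τ(X, Y) = (u⁻²X, u⁻³Y)` for `u = θ`. [folklore] -/
theorem twistMap_some {X Y : F} (h : (W.quadraticTwist c).toAffine.Nonsingular X Y) :
    ∃ h', twistMap W hθ hc (.some X Y h) =
      .some ((twistUntwist hθ).toX (algebraMap F K X))
        ((twistUntwist hθ).toY (algebraMap F K X) (algebraMap F K Y)) h' := by
  refine ⟨?_, ?_⟩
  · rw [← twistUntwist_smul_baseChange W hθ hc, VariableChange.nonsingular_iff]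
    exact (Affine.baseChange_nonsingular (W := W.quadraticTwist c) (f := Algebra.ofId F K)
      (algebraMap F K).injective X Y).mpr h
  · show Affine.Point.congrEquiv _ (VariableChange.pointEquiv _ _
      (Affine.Point.map (W' := W.quadraticTwist c) (Algebra.ofId F K) (.some X Y h))) = _
    rw [Affine.Point.map_some (W' := W.quadraticTwist c) (f := Algebra.ofId F K) h,
      VariableChange.pointEquiv_some, Affine.Point.congrEquiv_some]
    rfl

omit [NeZero (2 : F)] in
include hc in
/-- The `x`-coordinate of `τ(cX, ·)` is `X`: `θ⁻² · cX = X`. [folklore] -/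
theorem toX_twistUntwist (X : F) :
    (twistUntwist hθ).toX (algebraMap F K (c * X)) = algebraMap F K X := by
  have hθ0 : θ ≠ 0 := Literature.NumberTheory.QuadraticFields.Quadratic.ne_zero_of_not_mem_range hθ
  simp only [VariableChange.toX_def, twistUntwist, sub_zero, map_mul, ← hc, inv_pow,
    Units.val_inv_eq_inv_val, Units.val_mk0]
  field_simp

omit [NeZero (2 : F)] in
include hc in
/-- The `y`-coordinate of `τ(cX, c²Y)` is `Yθ`: `θ⁻³ · c²Y = θY`. [folklore] -/
theorem toY_twistUntwist (X Y : F) :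
    (twistUntwist hθ).toY (algebraMap F K (c * X)) (algebraMap F K (c ^ 2 * Y)) =
      algebraMap F K Y * θ := by
  have hθ0 : θ ≠ 0 := Literature.NumberTheory.QuadraticFields.Quadratic.ne_zero_of_not_mem_range hθ
  simp only [VariableChange.toY_def, twistUntwist, sub_zero, zero_mul, map_mul, map_pow, ← hc,
    inv_pow, Units.val_inv_eq_inv_val, Units.val_mk0]
  field_simp

/-- A point `(a, bθ)` of `W^{(1)}(K)` with `a, b ∈ F` is in the image of `τ`: it is
`τ(ca, c²b)`. [folklore] -/
theorem exists_twistMap_eq {x y : K} (h : ((W.quadraticTwist 1).baseChange K).toAffine.Nonsingular x y)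
    {a b : F} (hx : algebraMap F K a = x) (hy : algebraMap F K b * θ = y) :
    ∃ R : (W.quadraticTwist c).toAffine.Point, twistMap W hθ hc R = .some x y h := by
  subst hx hy
  have h1 : ((W.quadraticTwist 1).baseChange K).toAffine.Nonsingular
      ((twistUntwist hθ).toX (algebraMap F K (c * a)))
      ((twistUntwist hθ).toY (algebraMap F K (c * a)) (algebraMap F K (c ^ 2 * b))) := by
    rwa [toX_twistUntwist hθ hc, toY_twistUntwist hθ hc]
  have hR : (W.quadraticTwist c).toAffine.Nonsingular (c * a) (c ^ 2 * b) := by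
    rw [← twistUntwist_smul_baseChange W hθ hc, VariableChange.nonsingular_iff] at h1
    exact (Affine.baseChange_nonsingular (W := W.quadraticTwist c) (f := Algebra.ofId F K)
      (algebraMap F K).injective _ _).mp h1
  obtain ⟨h', e⟩ := twistMap_some W hθ hc hR
  refine ⟨_, e.trans ?_⟩
  simp only [Affine.Point.some.injEq]
  exact ⟨toX_twistUntwist hθ hc a, toY_twistUntwist hθ hc a b⟩

/-- **`σ ∘ τ = -τ`**: the conjugation acts by `-1` on the image of the twisting map (for `σ`
with `σθ = -θ`). Silverman, *AEC* X.2, proof of Prop. 2.4. [cite: SilvermanAEC2009, X.5 Cor. 5.4] -/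
theorem conjMap_twistMap {σ : K →ₐ[F] K} (hσ : σ θ = -θ) (R : (W.quadraticTwist c).toAffine.Point) :
    conjMap (W.quadraticTwist 1) σ (twistMap W hθ hc R) = -twistMap W hθ hc R := by
  rcases R with _ | ⟨X, Y, hR⟩
  · rw [← Affine.Point.zero_def, map_zero, map_zero, neg_zero]
  · obtain ⟨h', e⟩ := twistMap_some W hθ hc hR
    rw [e, Affine.Point.map_some, Affine.Point.neg_some]
    simp only [negY_quadraticTwist_one_baseChange, VariableChange.toX_def, VariableChange.toY_def,
      twistUntwist, sub_zero, zero_mul, inv_pow, Units.val_inv_eq_inv_val, Units.val_mk0, map_mul,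
      map_inv₀, map_pow, hσ, AlgHom.commutes, Even.neg_pow (by decide : Even 2),
      Odd.neg_pow (by decide : Odd 3), inv_neg, neg_mul]

end QuadraticDescent

open _root_.WeierstrassCurve.QuadraticDescent

/-! ### The rank identity -/

include h2 hθ hc in
/-- **`rank E'(K) = rank E'(F) + rank E^{(c)}(F)` for the completed-square model** `E' = W^{(1)}`
of `W` and `K = F(θ)`, `θ² = c`, `θ ∉ F`, `2 ≠ 0` (Silverman, *AEC*, Exercise 10.16), as an
identity of cardinals (`Module.rank ℤ`; no finite generation needed): the images of
`ι : E'(F) → E'(K)` and `τ : E^{(c)}(F) → E'(K)` meet in `E'(K)[2]` and together contain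
`2E'(K)`, by the eigenspace decomposition under the conjugation `σ`. [cite: SilvermanAEC2009, Exercise 10.16] -/
theorem lift_rank_point_baseChange_quadraticTwist_one :
    Cardinal.lift.{u} (Module.rank ℤ ((W.quadraticTwist 1).baseChange K).toAffine.Point) =
      Cardinal.lift.{v} (Module.rank ℤ (W.quadraticTwist 1).toAffine.Point) +
        Cardinal.lift.{v} (Module.rank ℤ (W.quadraticTwist c).toAffine.Point) := by
  set σ := Literature.NumberTheory.QuadraticFields.Quadratic.conj h2 hθ hc with hσdef
  have hσθ : σ θ = -θ := Literature.NumberTheory.QuadraticFields.Quadratic.conj_gen h2 hθ hc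
  have hσσ : ∀ z, σ (σ z) = z := Literature.NumberTheory.QuadraticFields.Quadratic.conj_conj h2 hθ hc
  set V := W.quadraticTwist 1 with hV
  set ιₗ := (incl K V).toIntLinearMap with hι
  set τₗ := (twistMap W hθ hc).toIntLinearMap with hτ
  have hιinj : Function.Injective ιₗ := incl_injective V
  have hτinj : Function.Injective τₗ := twistMap_injective W hθ hc
  -- fixed points of `σ` come from `F`, anti-fixed points from the twist
  have hfix : ∀ P : (V.baseChange K).toAffine.Point, conjMap V σ P = P → P ∈ LinearMap.range ιₗ := by
    rintro (_ | ⟨x, y, h⟩) hP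
    · exact ⟨0, (map_zero ιₗ).trans Affine.Point.zero_def⟩
    · rw [Affine.Point.map_some, Affine.Point.some.injEq] at hP
      obtain ⟨a, ha⟩ := Literature.NumberTheory.QuadraticFields.Quadratic.exists_eq_algebraMap_of_conj_eq h2 hθ hc hP.1
      obtain ⟨b, hb⟩ := Literature.NumberTheory.QuadraticFields.Quadratic.exists_eq_algebraMap_of_conj_eq h2 hθ hc hP.2
      obtain ⟨Q, hQ⟩ := exists_incl_eq V h ha.symm hb.symm
      exact ⟨Q, hQ⟩
  have hanti : ∀ P : (V.baseChange K).toAffine.Point, conjMap V σ P = -P →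
      P ∈ LinearMap.range τₗ := by
    rintro (_ | ⟨x, y, h⟩) hP
    · exact ⟨0, (map_zero τₗ).trans Affine.Point.zero_def⟩
    · rw [Affine.Point.map_some, Affine.Point.neg_some, Affine.Point.some.injEq,
        negY_quadraticTwist_one_baseChange] at hP
      obtain ⟨a, ha⟩ := Literature.NumberTheory.QuadraticFields.Quadratic.exists_eq_algebraMap_of_conj_eq h2 hθ hc hP.1
      obtain ⟨b, hb⟩ := Literature.NumberTheory.QuadraticFields.Quadratic.exists_eq_mul_of_conj_eq_neg h2 hθ hc hP.2
      obtain ⟨R, hR⟩ := exists_twistMap_eq W hθ hc h ha.symm hb.symm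
      exact ⟨R, hR⟩
  -- the rank computation
  have key := Literature.NumberTheory.EllipticCurves.rank_eq_add_of_isCompl_up_to_torsion (LinearMap.range ιₗ) (LinearMap.range τₗ)
    (n := 2) two_ne_zero ?_ ?_
  · apply_fun Cardinal.lift.{u} at key
    rw [Cardinal.lift_add, ← (LinearEquiv.ofInjective ιₗ hιinj).lift_rank_eq,
      ← (LinearEquiv.ofInjective τₗ hτinj).lift_rank_eq] at key
    exact key
  · -- `im ι ∩ im τ ⊆ E'(K)[2]`
    rintro x ⟨⟨Q, rfl⟩, ⟨R, hR⟩⟩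
    have h1 : conjMap V σ (ιₗ Q) = ιₗ Q := conjMap_incl V σ Q
    have h2' : conjMap V σ (ιₗ Q) = -ιₗ Q := by
      rw [← hR]
      exact conjMap_twistMap W hθ hc hσθ R
    rw [two_zsmul, add_eq_zero_iff_eq_neg, ← h2', h1]
  · -- `2P = (P + σP) + (P - σP)`
    intro P
    have e : (2 : ℤ) • P = (P + conjMap V σ P) + (P - conjMap V σ P) := by
      rw [two_zsmul]
      abel
    rw [e]
    refine Submodule.add_mem_sup (hfix _ ?_) (hanti _ ?_)
    · rw [map_add, conjMap_conjMap V hσσ, add_comm]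
    · rw [map_sub, conjMap_conjMap V hσσ, neg_sub]

include h2 hθ hc in
/-- **The rank over a quadratic extension** (Silverman, *The Arithmetic of Elliptic Curves*,
2nd ed., Exercise 10.16): for a field `F` with `2 ≠ 0`, a quadratic extension `K = F(θ)`,
`θ² = c ∈ F`, `θ ∉ F`, and any Weierstrass curve `W/F`,
`rank_ℤ W(K) = rank_ℤ W(F) + rank_ℤ W^{(c)}(F)` as cardinals (`Module.rank ℤ` of the groups of
nonsingular points; `W^{(c)} = W.quadraticTwist c`). Reduced to the completed-square model by the
change of variables `W ≅ W^{(1)}` over `F` (and over `K`). [cite: SilvermanAEC2009, Exercise 10.16] -/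
theorem lift_rank_point_baseChange_quadratic :
    Cardinal.lift.{u} (Module.rank ℤ (W.baseChange K).toAffine.Point) =
      Cardinal.lift.{v} (Module.rank ℤ W.toAffine.Point) +
        Cardinal.lift.{v} (Module.rank ℤ (W.quadraticTwist c).toAffine.Point) := by
  obtain ⟨C, hC⟩ := W.exists_variableChange_quadraticTwist_one
  have hCK : C.map (algebraMap F K) • W.baseChange K = (W.quadraticTwist 1).baseChange K := by
    rw [baseChange, baseChange, map_variableChange, hC]
  have e1 : W.toAffine.Point ≃+ (W.quadraticTwist 1).toAffine.Point :=
    (VariableChange.pointEquiv W C).trans (Affine.Point.congrEquiv hC)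
  have e2 : (W.baseChange K).toAffine.Point ≃+ ((W.quadraticTwist 1).baseChange K).toAffine.Point :=
    (VariableChange.pointEquiv (W.baseChange K) (C.map (algebraMap F K))).trans
      (Affine.Point.congrEquiv hCK)
  rw [e1.toIntLinearEquiv.rank_eq, e2.toIntLinearEquiv.rank_eq]
  exact lift_rank_point_baseChange_quadraticTwist_one W h2 hθ hc

end Quadratic

/-! ### Over `ℚ`: quadratic number fields -/

section Rat

variable (W : WeierstrassCurve ℚ) (K : Type) [Field K] [NumberField K]

/- Design note: over `ℚ` the statements below only mention `WeierstrassCurve.mordellWeilRank`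
(and the point group over `K`), never the type `W⟮ℚ⟯` itself: writing it here would elaborate
its group structure with `Rat`'s `DecidableEq` instance, whereas `mordellWeilRank` (defined for a
general field) carries the classical one; all point groups over `ℚ` are therefore obtained by
instantiating the general statements above at `F = ℚ`. -/

/-- **`rank E(K) = rank E(ℚ) + rank E^{(d_K)}(ℚ)` over a quadratic number field `K`** for the
Mordell–Weil rank (`Module.finrank`, `WeierstrassCurve.mordellWeilRank`) of any `E/ℚ`, with `d_K`
the discriminant (`K = ℚ(√d_K)`: `d_K = c q²` for any square-root generator `√c` of `K`,
`NumberField.exists_discr_eq_mul_sq`, and `E^{(c q²)} ≅ E^{(c)}` over `ℚ`), provided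
`rank_ℤ E(K)` is finite — e.g. `E(K)` finitely generated (Mordell–Weil) — which is what makes the
`finrank`s meaningful (Silverman, *AEC*, Exercise 10.16). [cite: SilvermanAEC2009, Exercise 10.16] -/
theorem mordellWeilRank_baseChange_of_finrank_eq_two (h2 : finrank ℚ K = 2)
    (hfin : Module.rank ℤ (W.baseChange K).toAffine.Point < Cardinal.aleph0) :
    (W.baseChange K).mordellWeilRank =
      W.mordellWeilRank + (W.quadraticTwist (NumberField.discr K : ℚ)).mordellWeilRank := by
  obtain ⟨θ, c, hθ, hc⟩ := Literature.NumberTheory.QuadraticFields.Quadratic.exists_sq_eq_algebraMap (F := ℚ) (K := K) h2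
  obtain ⟨q, hq, hd⟩ := NumberField.exists_discr_eq_mul_sq h2 hθ hc
  obtain ⟨C, hC⟩ := W.exists_variableChange_quadraticTwist_mul_sq c q hq
  rw [← hd] at hC
  have h := lift_rank_point_baseChange_quadratic W h2 hθ hc
  simp only [Cardinal.lift_id] at h
  rw [rank_point_eq_of_variableChange C hC] at h
  rw [h, Cardinal.add_lt_aleph0_iff] at hfin
  unfold mordellWeilRank finrank
  rw [h, Cardinal.toNat_add hfin.1 hfin.2]

/-- The same under the Mordell–Weil hypothesis `E(K)` finitely generated (`Module.Finite ℤ`).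
[cite: SilvermanAEC2009, Exercise 10.16] -/
theorem mordellWeilRank_baseChange_of_finrank_eq_two_of_finite (h2 : finrank ℚ K = 2)
    [Module.Finite ℤ (W.baseChange K).toAffine.Point] :
    (W.baseChange K).mordellWeilRank =
      W.mordellWeilRank + (W.quadraticTwist (NumberField.discr K : ℚ)).mordellWeilRank :=
  mordellWeilRank_baseChange_of_finrank_eq_two W K h2 (Module.rank_lt_aleph0 ℤ _)

/-- The same when `rank E(K)` is known to be a positive natural number `n` (as `finrank`; a
nonzero `finrank` is a genuine rank): then `rank E(ℚ) + rank E^{(d_K)}(ℚ) = n`. This is the form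
used with Kolyvagin's `rank E(K) = 1` in the proof of Gross–Zagier–Kolyvagin over `ℚ`
(Darmon 2004, §3.9). [cite: SilvermanAEC2009, Exercise 10.16] -/
theorem mordellWeilRank_add_eq_of_baseChange (h2 : finrank ℚ K = 2) {n : ℕ} (hn : n ≠ 0)
    (hK : (W.baseChange K).mordellWeilRank = n) :
    W.mordellWeilRank + (W.quadraticTwist (NumberField.discr K : ℚ)).mordellWeilRank = n := by
  have hfin : Module.rank ℤ (W.baseChange K).toAffine.Point < Cardinal.aleph0 := by
    rw [mordellWeilRank, finrank] at hK
    exact (Cardinal.toNat_ne_zero.mp (hK ▸ hn)).2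
  rw [← hK, mordellWeilRank_baseChange_of_finrank_eq_two W K h2 hfin]

end Rat

end WeierstrassCurve

end
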